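import Mathlib
import Summits.ValiantsHypothesis.ValiantsHypothesis.Theorems.BinomialElusiveBinomialCandidateAffinePeeling

/-!
# Crux `BinomialElusive.BinomialCandidate` (stmt-ValiantsHypothesis-7392), line `registered` —
# stub `stub_affineOrdersDependent` (∞-LA): the pure-algebra contradiction at the place at infinity

The registered stub `stub_affineOrdersDependent` of the crux
`Summit.ValiantsHypothesis.ValiantsHypothesis.Theses.BinomialElusive.BinomialCandidate`.

Data: `s < m`, a nonzero vector `z ∈ ℂ^s`, `m` polynomials `A_i` on `ℂ^s` of total degree `≤ 1`
whose linear parts annihilate `z` (`Σ_k z_k · coeff_{X_k} A_i = 0`), a Laurent arc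
`r ∈ ℂ((t))^s` along which every `A_i(r)` is a nonzero Laurent series, and pairwise distinct
orders `e_i = ord A_i(r)`.  Conclusion: `False`.

Proof (three steps, Mathlib plus the `AffinePeeling` helpers of the imported tree file).

* `AffineOrdersDependent.exists_relation` — a nontrivial relation `Σ_i l_i A_i = 0`, i.e.
  `l ≠ 0` with `Σ_i l_i coeff_0 A_i = 0` and `Σ_i l_i coeff_{X_k} A_i = 0` for every `k`.
  Pick `j₀` with `z_{j₀} ≠ 0` and take a nonzero left-kernel vector `l` of the `m × s` matrix
  `E_{ik} = coeff_0 A_i` (`k = j₀`), `coeff_{X_k} A_i` (`k ≠ j₀`)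
  (`AffinePeeling.exists_ne_zero_leftKernel`, `s < m`); the missing column `k = j₀` is recovered
  from the hypothesis: `0 = Σ_i l_i Σ_k z_k coeff_{X_k} A_i = z_{j₀} Σ_i l_i coeff_{X_{j₀}} A_i`.
* `AffineOrdersDependent.sum_smul_aeval_eq_zero` — evaluating along `r`:
  `Σ_i l_i • A_i(r) = 0` (affine normal form `AffinePeeling.aeval_eq_of_totalDegree_le_one`,
  swap the sums).
* `AffineOrdersDependent.eq_zero_of_sum_smul_eq_zero` — nonzero Laurent series with pairwise
  distinct orders are `ℂ`-linearly independent: with `i₀` the index of least order among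
  `{i : l_i ≠ 0}` (`Finset.exists_min_image`), the `t^{e_{i₀}}` coefficient of `Σ_i l_i • F_i`
  is `l_{i₀} · (F_{i₀}).coeff e_{i₀} ≠ 0` (`HahnSeries.coeff_eq_zero_of_lt_order`,
  `HahnSeries.coeff_order_eq_zero`).
-/

-- layout Summits/ValiantsHypothesis/ValiantsHypothesis forces the duplicated namespace component
set_option linter.dupNamespace false

namespace Summit.ValiantsHypothesis.ValiantsHypothesis.Theorems.BinomialCandidateStubs

open scoped BigOperators

namespace AffineOrdersDependent

/-- **Step 1: the linear relation.**  If `s < m`, `z ≠ 0` and the linear parts of the `A_i`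
annihilate `z`, there is `l ≠ 0` with `Σ_i l_i coeff_0 A_i = 0` and
`Σ_i l_i coeff_{X_k} A_i = 0` for every `k` (so `Σ_i l_i A_i = 0` when the `A_i` are affine). -/
theorem exists_relation {m s : ℕ} (hsm : s < m) (z : Fin s → ℂ) (hz : z ≠ 0)
    (A : Fin m → MvPolynomial (Fin s) ℂ)
    (hAz : ∀ i, ∑ k, z k * MvPolynomial.coeff (Finsupp.single k 1) (A i) = 0) :
    ∃ l : Fin m → ℂ, l ≠ 0 ∧ ∑ i, l i * MvPolynomial.coeff 0 (A i) = 0 ∧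
      ∀ k, ∑ i, l i * MvPolynomial.coeff (Finsupp.single k 1) (A i) = 0 := by
  classical
  obtain ⟨j₀, hj₀⟩ := Function.ne_iff.mp hz
  -- the `m × s` matrix: column `j₀` carries the constant terms, the other columns the linear ones
  let E : Fin m → Fin s → ℂ := fun i k =>
    if k = j₀ then MvPolynomial.coeff 0 (A i) else MvPolynomial.coeff (Finsupp.single k 1) (A i)
  obtain ⟨l, hlne, hlker⟩ := AffinePeeling.exists_ne_zero_leftKernel hsm E
  have h0 : ∑ i, l i * MvPolynomial.coeff 0 (A i) = 0 := by
    have h := hlker j₀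
    simpa [E] using h
  have hk : ∀ k, k ≠ j₀ → ∑ i, l i * MvPolynomial.coeff (Finsupp.single k 1) (A i) = 0 := by
    intro k hkj
    have h := hlker k
    simpa [E, hkj] using h
  -- the column `j₀` of the linear parts, from `Σ_k z_k coeff_{X_k} A_i = 0`
  have hj0 : ∑ i, l i * MvPolynomial.coeff (Finsupp.single j₀ 1) (A i) = 0 := by
    have hsum : ∑ k, z k * ∑ i, l i * MvPolynomial.coeff (Finsupp.single k 1) (A i) = 0 := by
      calc ∑ k, z k * ∑ i, l i * MvPolynomial.coeff (Finsupp.single k 1) (A i)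
          = ∑ i, l i * ∑ k, z k * MvPolynomial.coeff (Finsupp.single k 1) (A i) := by
            simp only [Finset.mul_sum]
            rw [Finset.sum_comm]
            exact Finset.sum_congr rfl fun i _ => Finset.sum_congr rfl fun k _ => by ring
        _ = 0 := Finset.sum_eq_zero fun i _ => by rw [hAz i, mul_zero]
    rw [Finset.sum_eq_single j₀ (fun k _ hkj => by rw [hk k hkj, mul_zero]) (by simp)] at hsum
    exact (mul_eq_zero.mp hsum).resolve_left hj₀
  refine ⟨l, hlne, h0, fun k => ?_⟩
  by_cases hkj : k = j₀
  · rw [hkj]; exact hj0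
  · exact hk k hkj

/-- `single 0 c` is the scalar `c` acting on `1` (coefficientwise scalar action). -/
theorem single_zero_eq_smul_one (c : ℂ) :
    HahnSeries.single (0 : ℤ) c = c • (1 : LaurentSeries ℂ) := by
  rw [← HahnSeries.single_zero_mul_eq_smul, mul_one]

/-- **Step 2: evaluation along the arc.**  For affine `A_i` and a relation as in Step 1,
`Σ_i l_i • A_i(r) = 0`. -/
theorem sum_smul_aeval_eq_zero {m s : ℕ} (A : Fin m → MvPolynomial (Fin s) ℂ)
    (hA : ∀ i, (A i).totalDegree ≤ 1) (r : Fin s → LaurentSeries ℂ) (l : Fin m → ℂ)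
    (h0 : ∑ i, l i * MvPolynomial.coeff 0 (A i) = 0)
    (h1 : ∀ k, ∑ i, l i * MvPolynomial.coeff (Finsupp.single k 1) (A i) = 0) :
    ∑ i, l i • MvPolynomial.aeval r (A i) = 0 := by
  classical
  have haff : ∀ i, l i • MvPolynomial.aeval r (A i) =
      (l i * MvPolynomial.coeff 0 (A i)) • (1 : LaurentSeries ℂ) +
        ∑ k, (l i * MvPolynomial.coeff (Finsupp.single k 1) (A i)) • r k := by
    intro i
    rw [AffinePeeling.aeval_eq_of_totalDegree_le_one (A i) (hA i) r, smul_add, Finset.smul_sum]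
    congr 1
    · rw [AffinePeeling.algebraMap_laurentSeries_apply, single_zero_eq_smul_one, smul_smul]
    · refine Finset.sum_congr rfl fun k _ => ?_
      rw [AffinePeeling.algebraMap_laurentSeries_apply, HahnSeries.single_zero_mul_eq_smul, smul_smul]
  have hc : ∑ i, (l i * MvPolynomial.coeff 0 (A i)) • (1 : LaurentSeries ℂ) = 0 := by
    rw [← Finset.sum_smul, h0, zero_smul]
  have hl : ∑ i, ∑ k, (l i * MvPolynomial.coeff (Finsupp.single k 1) (A i)) • r k = 0 := by
    rw [Finset.sum_comm]
    refine Finset.sum_eq_zero fun k _ => ?_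
    rw [← Finset.sum_smul, h1 k, zero_smul]
  simp only [haff, Finset.sum_add_distrib, hc, hl, add_zero]

/-- **Step 3: distinct orders are independent.**  If the `F_i` are nonzero Laurent series with
pairwise distinct orders `e_i` and `Σ_i l_i • F_i = 0`, then `l = 0`: the `t^{e_{i₀}}`
coefficient of the sum, `i₀` the index of least order among `{i : l_i ≠ 0}`, is
`l_{i₀} · (F_{i₀}).coeff e_{i₀} ≠ 0`. -/
theorem eq_zero_of_sum_smul_eq_zero {m : ℕ} (F : Fin m → LaurentSeries ℂ) (e : Fin m → ℤ)
    (he : Function.Injective e) (hF : ∀ i, F i ≠ 0) (hFe : ∀ i, (F i).order = e i)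
    (l : Fin m → ℂ) (hl : ∑ i, l i • F i = 0) : l = 0 := by
  classical
  by_contra hlne
  set I : Finset (Fin m) := Finset.univ.filter fun i => l i ≠ 0 with hI_def
  have hI : I.Nonempty := by
    obtain ⟨i, hi⟩ := Function.ne_iff.mp hlne
    exact ⟨i, Finset.mem_filter.mpr ⟨Finset.mem_univ _, hi⟩⟩
  obtain ⟨i₀, hi₀I, hmin⟩ := Finset.exists_min_image I e hI
  have hli₀ : l i₀ ≠ 0 := (Finset.mem_filter.mp hi₀I).2
  have h := congr_arg (fun x : LaurentSeries ℂ => x.coeff (e i₀)) hl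
  simp only [HahnSeries.coeff_sum, HahnSeries.coeff_smul, smul_eq_mul, HahnSeries.coeff_zero] at h
  rw [Finset.sum_eq_single i₀] at h
  · have hc : (F i₀).coeff (e i₀) ≠ 0 := by
      rw [← hFe i₀]
      exact HahnSeries.coeff_order_eq_zero.not.mpr (hF i₀)
    exact mul_ne_zero hli₀ hc h
  · intro i _ hi
    by_cases hli : l i = 0
    · rw [hli, zero_mul]
    · have hle : e i₀ ≤ e i := hmin i (Finset.mem_filter.mpr ⟨Finset.mem_univ _, hli⟩)
      have hlt : e i₀ < e i := lt_of_le_of_ne hle fun h' => hi (he h').symm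
      rw [HahnSeries.coeff_eq_zero_of_lt_order (by rw [hFe i]; exact hlt), mul_zero]
  · intro h'
    exact absurd (Finset.mem_univ _) h'

end AffineOrdersDependent

/-- **Registered stub `stub_affineOrdersDependent` (∞-LA).**  `m` affine polynomials on `ℂ^s`,
`s < m`, whose linear parts annihilate a nonzero `z`, cannot take along a Laurent arc `r` nonzero
values with pairwise distinct orders: a nontrivial relation `Σ_i l_i A_i = 0`
(`AffineOrdersDependent.exists_relation`) evaluated along `r`
(`AffineOrdersDependent.sum_smul_aeval_eq_zero`) contradicts the independence of Laurent
series with distinct orders (`AffineOrdersDependent.eq_zero_of_sum_smul_eq_zero`). -/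
theorem stub_affineOrdersDependent :
    ∀ (m s : ℕ) (z : Fin s → ℂ) (A : Fin m → MvPolynomial (Fin s) ℂ) (r : Fin s → LaurentSeries ℂ) (e : Fin m → ℤ),
      s < m → z ≠ 0 → (∀ i, (A i).totalDegree ≤ 1) →
      (∀ i, ∑ k, z k * MvPolynomial.coeff (Finsupp.single k 1) (A i) = 0) →
      Function.Injective e →
      (∀ i, MvPolynomial.aeval r (A i) ≠ 0) → (∀ i, (MvPolynomial.aeval r (A i)).order = e i) → False := by
  intro m s z A r e hsm hz hA hAz he hne hord
  obtain ⟨l, hlne, h0, h1⟩ := AffineOrdersDependent.exists_relation hsm z hz A hAz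
  exact hlne (AffineOrdersDependent.eq_zero_of_sum_smul_eq_zero (fun i => MvPolynomial.aeval r (A i)) e
    he hne hord l (AffineOrdersDependent.sum_smul_aeval_eq_zero A hA r l h0 h1))

end Summit.ValiantsHypothesis.ValiantsHypothesis.Theorems.BinomialCandidateStubs
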